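import Literature.Geometry.Riemannian.VolumeScaling
import Literature.Geometry.Riemannian.NeckScaling
import Literature.Geometry.Riemannian.RicciFlowMaximalScaling
import HarnessLib

/-!
# The canonical neighbourhood assumption under parabolic rescaling
(topic `Geometry/Riemannian`)

Assembly of `MetricTraceScaling.lean` (`R(a g) = a⁻¹ R(g)`, `|dψ|²_{a g} = a⁻¹ |dψ|²_g`),
`RiemannianDistanceScaling.lean` (`B_{a g}(x, √a σ) = B_g(x, σ)`), `VolumeScaling.lean`
(`Vol_{a g} = a² Vol_g` in dimension `4`) and `NeckScaling.lean` (strong necks, caps, positive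
curvature operator): **Chen–Zhu's canonical neighbourhood assumption is invariant under the
parabolic rescaling `g(t) ↦ a g(t/a)`** of a flow on `[0, T)` (`a > 0`) — if `(x, t)` has a
canonical neighbourhood with accuracy `ε` and constants `C₁, C₂, η` for `(g, ∇)` on `[0, T)`, then
`(x, a t)` has one, with the SAME `ε, C₁, C₂, η`, for the rescaled flow on `[0, a T)`
(`HasCanonicalNeighbourhood.parabolicRescale`; the neighbourhood `B` is the same, `σ ↦ √a σ`).
Every clause of the assumption (Chen–Zhu 2006, §5, arXiv p. 26) is dimensionless:
`σ < C₁ R^{-1/2}`, `B_t(x, σ) ⊆ B ⊆ B_t(x, 2σ)`, `(C₂ R)⁻² ≤ Vol_t(B)`, `C₂⁻¹ R ≤ R(y) ≤ C₂ R`,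
`|∇R| < η R^{3/2}`, `|∂R/∂t| < η R²`, and (a)/(b)/(c) ("after scaling with the factor `R(x,t)`").
This is what the normalisation "Without loss of generality, after a scaling on the initial metric,
we may assume `T₀ > 1`" (p. 26) uses of the assumption; it is recorded here, with the two
auxiliary identities `gradSq_const_mul` (`|d(c f)|² = c² |df|²`) and
`derivWithin_inv_mul_comp_inv_mul` (time derivatives of `s ↦ a⁻¹ φ(s/a)` on `[0, a T)`).

## References

* B.-L. Chen, X.-P. Zhu, *Ricci flow with surgery on four-manifolds with positive isotropic
  curvature*, J. Differential Geom. 74 (2006), arXiv:math/0504478, §5, p. 26 (the canonical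
  neighbourhood assumption; "we may assume `T₀ > 1`"). [ChenZhu2006]
* P. Topping, *Lectures on the Ricci flow* (2006), §1.2.3 (parabolic rescaling). [Topping2006]
-/

noncomputable section

open Bundle Set Filter TopologicalSpace
open scoped Manifold ContDiff Topology ENNReal

namespace Literature.Geometry.Riemannian

open Literature.Geometry.Lorentzian (PseudoRiemannianMetric)
open Literature.Geometry.Lorentzian.PseudoRiemannianMetric

/-! ### Two auxiliary identities -/

section GradSq

variable {E : Type*} [NormedAddCommGroup E] [NormedSpace ℝ E] {H : Type*} [TopologicalSpace H]
  {I : ModelWithCorners ℝ E H} {M : Type*} [TopologicalSpace M] [ChartedSpace H M]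
  [IsManifold I ∞ M] {n : ℕ∞ω} [FiniteDimensional ℝ E]

/-- The gradient square is quadratic in the function: `|d(c f)|²_g = c² |df|²_g` (with Mathlib's
junk conventions, `mvfderiv_const_mul`). [folklore] -/
theorem _root_.Literature.Geometry.Lorentzian.PseudoRiemannianMetric.gradSq_const_mul
    (g : PseudoRiemannianMetric I n E (TangentSpace I : M → Type _)) (f : M → ℝ) (c : ℝ) (x : M) :
    g.gradSq (fun y ↦ c * f y) x = c ^ 2 * g.gradSq f x := by
  simp only [PseudoRiemannianMetric.gradSq, PseudoRiemannianMetric.innerDual, mvfderiv_const_mul,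
    ContinuousLinearMap.toLinearMap_smul, map_smul, LinearMap.smul_apply, smul_eq_mul]
  ring

end GradSq

section TimeRescaling

/-- **Time derivatives under parabolic rescaling**: for `a > 0` and `t ∈ [0, T)`, the function
`s ↦ a⁻¹ φ(s/a)` has derivative `a⁻² φ'(t)` within `[0, a T)` at `s = a t`, `φ'(t)` the
derivative of `φ` within `[0, T)` — valid with Mathlib's junk value `0` when `φ` is not
differentiable within `[0, T)` at `t` (the rescaled function is then not differentiable either).
This is `∂R/∂t ↦ λ⁻² ∂R/∂t` under `g ↦ λ g`, `t ↦ λ t`. [folklore] -/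
theorem derivWithin_inv_mul_comp_inv_mul {φ : ℝ → ℝ} {T t a : ℝ} (ha : 0 < a) (ht : t ∈ Ico 0 T) :
    derivWithin (fun s ↦ a⁻¹ * φ (a⁻¹ * s)) (Ico 0 (a * T)) (a * t) =
      a⁻¹ ^ 2 * derivWithin φ (Ico 0 T) t := by
  have haT : a * t ∈ Ico 0 (a * T) := ⟨mul_nonneg ha.le ht.1, mul_lt_mul_of_pos_left ht.2 ha⟩
  have hmaps : MapsTo (fun s : ℝ ↦ a⁻¹ * s) (Ico 0 (a * T)) (Ico 0 T) := by
    intro s hs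
    refine ⟨mul_nonneg (inv_nonneg.mpr ha.le) hs.1, ?_⟩
    rw [inv_mul_lt_iff₀ ha]
    exact hs.2
  have hmaps' : MapsTo (fun s : ℝ ↦ a * s) (Ico 0 T) (Ico 0 (a * T)) :=
    fun s hs ↦ ⟨mul_nonneg ha.le hs.1, mul_lt_mul_of_pos_left hs.2 ha⟩
  have huniq : UniqueDiffWithinAt ℝ (Ico 0 (a * T)) (a * t) := uniqueDiffOn_Ico 0 (a * T) _ haT
  by_cases hφ : DifferentiableWithinAt ℝ φ (Ico 0 T) t
  · -- chain rule
    have hinner : HasDerivWithinAt (fun s : ℝ ↦ a⁻¹ * s) a⁻¹ (Ico 0 (a * T)) (a * t) := by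
      simpa using (hasDerivWithinAt_id (a * t) (Ico 0 (a * T))).const_mul a⁻¹
    have hφ' : HasDerivWithinAt φ (derivWithin φ (Ico 0 T) t) (Ico 0 T) (a⁻¹ * (a * t)) := by
      rw [inv_mul_cancel_left₀ ha.ne']
      exact hφ.hasDerivWithinAt
    have hcomp := hφ'.scomp (a * t) hinner hmaps
    have hall : HasDerivWithinAt (fun s ↦ a⁻¹ * φ (a⁻¹ * s))
        (a⁻¹ * (a⁻¹ • derivWithin φ (Ico 0 T) t)) (Ico 0 (a * T)) (a * t) :=
      hcomp.const_mul a⁻¹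
    rw [hall.derivWithin huniq, smul_eq_mul]
    ring
  · -- both sides are the junk value `0`
    rw [derivWithin_zero_of_not_differentiableWithinAt hφ, mul_zero,
      derivWithin_zero_of_not_differentiableWithinAt]
    intro hψ
    apply hφ
    have hinner : DifferentiableWithinAt ℝ (fun s : ℝ ↦ a * s) (Ico 0 T) t :=
      differentiableWithinAt_id.const_mul a
    have hcomp := hψ.comp t hinner hmaps'
    have hfun : (fun s ↦ a * ((fun s ↦ a⁻¹ * φ (a⁻¹ * s)) ∘ fun s ↦ a * s) s) = φ := by
      funext s
      simp only [Function.comp_apply, inv_mul_cancel_left₀ ha.ne', mul_inv_cancel_left₀ ha.ne']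
    have := hcomp.const_mul a
    rwa [hfun] at this

end TimeRescaling

/-! ### The canonical neighbourhood assumption is scale-invariant -/

section Canonical

variable {M : Type*} [TopologicalSpace M] [ChartedSpace (EuclideanSpace ℝ (Fin 4)) M]
  [IsManifold (𝓡 4) ∞ M] [T3Space M] [MeasurableSpace M] [BorelSpace M]

/-- **Canonical neighbourhoods under parabolic rescaling** (Chen–Zhu 2006, §5, p. 26: every
clause of the canonical neighbourhood assumption is dimensionless; p. 26: "Without loss of
generality, after a scaling on the initial metric, we may assume `T₀ > 1`"): if `(x, t)`,
`t ∈ [0, T)`, has a canonical neighbourhood with accuracy `ε` and constants `C₁, C₂, η` for the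
flow `(g, ∇)` on `[0, T)`, then `(x, a t)` has one with the same `ε, C₁, C₂, η` for the rescaled
flow `τ ↦ a · g(τ/a)`, `τ ↦ ∇(τ/a)` on `[0, a T)` (`a > 0`): same `B`, `σ ↦ √a σ`, the strong
neck / cap / positive-curvature-operator alternative by `IsStrongEpsNeck.parabolicRescale`,
`isEpsCap_constSmul_iff`, `hasPositiveCurvatureOperatorOn_constSmul_iff`, balls by
`ball_constSmul_ofReal`, volumes by `vol_constSmul_four`, curvatures by
`scalarCurvatureWith_constSmul`, `gradSq_constSmul`, `gradSq_const_mul` and the time derivative by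
`derivWithin_inv_mul_comp_inv_mul`. [cite: ChenZhu2006, §5, p. 26 (canonical neighborhood assumption)] -/
theorem HasCanonicalNeighbourhood.parabolicRescale
    {g : ℝ → PseudoRiemannianMetric (𝓡 4) ∞ (EuclideanSpace ℝ (Fin 4)) (TangentSpace (𝓡 4) : M → Type _)}
    {cov : ℝ → CovariantDerivative (𝓡 4) (EuclideanSpace ℝ (Fin 4)) (TangentSpace (𝓡 4) : M → Type _)}
    {T : ℝ} {x : M} {t ε C₁ C₂ η a : ℝ} (ha : 0 < a) (ht : t ∈ Ico 0 T)
    (h : HasCanonicalNeighbourhood g cov (Ico 0 T) x t ε C₁ C₂ η) :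
    HasCanonicalNeighbourhood (fun τ ↦ (g (a⁻¹ * τ)).constSmul a ha.ne') (fun τ ↦ cov (a⁻¹ * τ))
      (Ico 0 (a * T)) x (a * t) ε C₁ C₂ η := by
  obtain ⟨B, σ, hσ, hσC, hin, hout, halt, hcomp, hgrad⟩ := h
  have hat : a⁻¹ * (a * t) = t := inv_mul_cancel_left₀ ha.ne' t
  have hsa : 0 < Real.sqrt a := Real.sqrt_pos.mpr ha
  have hR' : ∀ y, ((g t).constSmul a ha.ne').scalarCurvatureWith (cov t) y =
      a⁻¹ * (g t).scalarCurvatureWith (cov t) y :=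
    fun y ↦ scalarCurvatureWith_constSmul _ _ _ _ _
  have hS : ∀ τ ∈ Ico (0 : ℝ) T, a * τ ∈ Ico 0 (a * T) :=
    fun τ hτ ↦ ⟨mul_nonneg ha.le hτ.1, mul_lt_mul_of_pos_left hτ.2 ha⟩
  -- the volume bookkeeping `(C₂ a⁻¹ R)⁻² = a² (C₂ R)⁻²`
  have hvolC : (C₂ * (a⁻¹ * (g t).scalarCurvatureWith (cov t) x))⁻¹ ^ 2 =
      a ^ 2 * (C₂ * (g t).scalarCurvatureWith (cov t) x)⁻¹ ^ 2 := by
    simp only [mul_inv, inv_inv]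
    ring
  have hvol' : ENNReal.ofReal ((C₂ * (g t).scalarCurvatureWith (cov t) x)⁻¹ ^ 2) ≤ (g t).vol B →
      ENNReal.ofReal ((C₂ * (a⁻¹ * (g t).scalarCurvatureWith (cov t) x))⁻¹ ^ 2) ≤
        ((g t).constSmul a ha.ne').vol B := by
    intro hv
    rw [hvolC, ENNReal.ofReal_mul (sq_nonneg a), vol_constSmul_four _ ha]
    gcongr
  refine ⟨B, Real.sqrt a * σ, mul_pos hsa hσ, ?_, ?_, ?_, ?_, ?_, ?_⟩
  · -- `√a σ < C₁ / √(a⁻¹ R)`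
    simp only [hat]
    rw [hR' x, Real.sqrt_mul (inv_nonneg.mpr ha.le), Real.sqrt_inv, mul_comm (Real.sqrt a)⁻¹,
      ← div_div, div_inv_eq_mul]
    have := mul_lt_mul_of_pos_right hσC hsa
    linarith [mul_comm (Real.sqrt a) σ]
  · -- inner ball
    simp only [hat]
    rw [ball_constSmul_ofReal _ ha]
    exact hin
  · -- outer ball
    simp only [hat]
    rw [mul_left_comm, ball_constSmul_ofReal _ ha]
    exact hout
  · -- the three alternatives
    simp only [hat]
    rw [hR' x]
    rcases halt with ⟨hneck, hvol⟩ | ⟨hcap, hvol⟩ | ⟨hK, hpco⟩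
    · exact Or.inl ⟨hneck.parabolicRescale ha hS, hvol' hvol⟩
    · exact Or.inr (Or.inl ⟨(isEpsCap_constSmul_iff ha).mpr hcap, hvol' hvol⟩)
    · exact Or.inr (Or.inr ⟨hK, (hasPositiveCurvatureOperatorOn_constSmul_iff ha).mpr hpco⟩)
  · -- curvature comparability
    simp only [hat]
    intro y hy
    obtain ⟨h1, h2⟩ := hcomp y hy
    rw [hR' x, hR' y]
    constructor
    · rw [mul_left_comm]
      exact mul_le_mul_of_nonneg_left h1 (inv_nonneg.mpr ha.le)
    · rw [mul_left_comm]
      exact mul_le_mul_of_nonneg_left h2 (inv_nonneg.mpr ha.le)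
  · -- gradient estimates
    simp only [hat]
    intro y hy
    obtain ⟨hg1, hg2⟩ := hgrad y hy
    constructor
    · have hfun : (fun z ↦ ((g t).constSmul a ha.ne').scalarCurvatureWith (cov t) z) =
          fun z ↦ a⁻¹ * (g t).scalarCurvatureWith (cov t) z := funext hR'
      set u := Real.sqrt a⁻¹ with hu
      have hu0 : 0 < u := Real.sqrt_pos.mpr (inv_pos.mpr ha)
      have hu2 : u ^ 2 = a⁻¹ := Real.sq_sqrt (inv_nonneg.mpr ha.le)
      rw [hfun, gradSq_constSmul, gradSq_const_mul, hR' y, ← hu2]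
      have e1 : u ^ 2 * ((u ^ 2) ^ 2 *
          (g t).gradSq (fun z ↦ (g t).scalarCurvatureWith (cov t) z) y) =
          (u ^ 3) ^ 2 * (g t).gradSq (fun z ↦ (g t).scalarCurvatureWith (cov t) z) y := by ring
      rw [e1, Real.sqrt_mul (sq_nonneg (u ^ 3)), Real.sqrt_sq (pow_pos hu0 3).le,
        Real.sqrt_mul (sq_nonneg u), Real.sqrt_sq hu0.le]
      have key : η * (u ^ 2 * (g t).scalarCurvatureWith (cov t) y *
          (u * Real.sqrt ((g t).scalarCurvatureWith (cov t) y))) =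
          u ^ 3 * (η * ((g t).scalarCurvatureWith (cov t) y *
            Real.sqrt ((g t).scalarCurvatureWith (cov t) y))) := by ring
      rw [key]
      exact mul_lt_mul_of_pos_left hg1 (pow_pos hu0 3)
    · set φ : ℝ → ℝ := fun s' ↦ (g s').scalarCurvatureWith (cov s') y with hφ
      have hfun2 : (fun s ↦ ((g (a⁻¹ * s)).constSmul a ha.ne').scalarCurvatureWith
          (cov (a⁻¹ * s)) y) = fun s ↦ a⁻¹ * φ (a⁻¹ * s) := by
        funext s
        exact scalarCurvatureWith_constSmul _ _ _ _ _
      rw [hfun2, derivWithin_inv_mul_comp_inv_mul (φ := φ) ha ht, hR' y, abs_mul,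
        abs_of_pos (by positivity : (0 : ℝ) < a⁻¹ ^ 2)]
      have key : η * (a⁻¹ * (g t).scalarCurvatureWith (cov t) y) ^ 2 =
          a⁻¹ ^ 2 * (η * (g t).scalarCurvatureWith (cov t) y ^ 2) := by ring
      rw [key]
      exact mul_lt_mul_of_pos_left hg2 (by positivity)

end Canonical

/-! ### Application: the canonical neighbourhood assumption for the smooth solution, unnormalised -/

/-- **"Without loss of generality, after a scaling on the initial metric, we may assume `T₀ > 1`"**
(Chen–Zhu 2006, §5, p. 26) — carried out: the named fact
`chenZhu_aprioriAssumptions_smoothSolution` (`CanonicalNeighbourhoods.lean`; Thm. 4.1 as used on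
p. 26, vended for maximal flows with `T > 1`) implies the same statement for EVERY maximal Ricci
flow from a metric of positive isotropic curvature on a closed simply connected 4-manifold, with
the same `η, ε₀, C₁(ε), C₂(ε)` and a parameter `r` depending on the solution: rescale the flow
parabolically by `λ = 2/T` (`IsMaximalRicciFlow.parabolicRescale`, final time `2 > 1`, initial
metric again PIC), take the parameter `r̂` of the rescaled flow, set `r(t) = r̂(λ t)/√λ`
(positive, non-increasing), and transport the canonical neighbourhoods back with
`HasCanonicalNeighbourhood.parabolicRescale` for the factor `λ⁻¹` (`R̂(x, λt) = λ⁻¹ R(x, t)`, so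
`R ≥ r(t)⁻²` iff `R̂ ≥ r̂(λt)⁻²`). [cite: ChenZhu2006, §5, p. 26] -/
theorem canonicalNeighbourhoods_smoothSolution_of_normalised
    (h : chenZhu_aprioriAssumptions_smoothSolution) :
    ∃ η : ℝ, 0 < η ∧ ∃ ε₀ : ℝ, 0 < ε₀ ∧ ∀ ε : ℝ, 0 < ε → ε ≤ ε₀ → ∃ C₁ C₂ : ℝ, 0 < C₁ ∧ 0 < C₂ ∧
      ∀ (M : Type) [TopologicalSpace M] [T2Space M] [SecondCountableTopology M] [CompactSpace M]
        [ChartedSpace (EuclideanSpace ℝ (Fin 4)) M] [IsManifold (𝓡 4) ∞ M] [SimplyConnectedSpace M]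
        [MeasurableSpace M] [BorelSpace M]
        (g : ℝ → PseudoRiemannianMetric (𝓡 4) ∞ (EuclideanSpace ℝ (Fin 4))
          (TangentSpace (𝓡 4) : M → Type _))
        (cov : ℝ → CovariantDerivative (𝓡 4) (EuclideanSpace ℝ (Fin 4))
          (TangentSpace (𝓡 4) : M → Type _)) (T : ℝ),
        IsMaximalRicciFlow g cov T → (g 0).HasPositiveIsotropicCurvature →
          ∃ r : ℝ → ℝ, (∀ t ∈ Ici (0 : ℝ), 0 < r t) ∧ AntitoneOn r (Ici 0) ∧
            ∀ t ∈ Ico 0 T, ∀ x : M,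
              (r t)⁻¹ ^ 2 ≤ (g t).scalarCurvatureWith (cov t) x →
                HasCanonicalNeighbourhood g cov (Ico 0 T) x t ε C₁ C₂ η := by
  obtain ⟨η, hη, ε₀, hε₀, H⟩ := h
  refine ⟨η, hη, ε₀, hε₀, fun ε hε hεε₀ ↦ ?_⟩
  obtain ⟨C₁, C₂, hC₁, hC₂, HM⟩ := H ε hε hεε₀
  refine ⟨C₁, C₂, hC₁, hC₂, fun M _ _ _ _ _ _ _ _ _ g cov T hmax hpic ↦ ?_⟩
  -- rescale by `c = 2/T`: a maximal flow on `[0, 2)` with PIC initial metric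
  set c : ℝ := 2 / T with hcdef
  have hc : 0 < c := div_pos two_pos hmax.pos
  have hmax' := hmax.parabolicRescale hc
  have hcT : c * T = 2 := by rw [hcdef, div_mul_cancel₀ _ hmax.pos.ne']
  have hone : (1 : ℝ) < c * T := by rw [hcT]; norm_num
  have hpic' : ((fun t ↦ (g (c⁻¹ * t)).constSmul c hc.ne') 0).HasPositiveIsotropicCurvature := by
    simpa using hpic.constSmul hc
  obtain ⟨r', hr'pos, hr'anti, Hcn⟩ := HM M _ _ (c * T) hmax' hone hpic'
  -- the parameter for the original flow
  have hsc : 0 < Real.sqrt c := Real.sqrt_pos.mpr hc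
  refine ⟨fun t ↦ r' (c * t) / Real.sqrt c, fun t ht ↦ ?_, fun t ht s hs hts ↦ ?_,
    fun t ht x hR ↦ ?_⟩
  · exact div_pos (hr'pos _ (by simpa using mul_nonneg hc.le (mem_Ici.mp ht))) hsc
  · -- non-increasing
    have hct : c * t ∈ Ici (0 : ℝ) := by simpa using mul_nonneg hc.le (mem_Ici.mp ht)
    have hcs : c * s ∈ Ici (0 : ℝ) := by simpa using mul_nonneg hc.le (mem_Ici.mp hs)
    exact div_le_div_of_nonneg_right (hr'anti hct hcs (mul_le_mul_of_nonneg_left hts hc.le))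
      hsc.le
  · -- transport the canonical neighbourhood of the rescaled flow at `(x, c t)` back
    have hct : c * t ∈ Ico 0 (c * T) := ⟨mul_nonneg hc.le ht.1, mul_lt_mul_of_pos_left ht.2 hc⟩
    have hR' : (r' (c * t))⁻¹ ^ 2 ≤ ((fun τ ↦ (g (c⁻¹ * τ)).constSmul c hc.ne') (c * t)).scalarCurvatureWith
        ((fun τ ↦ cov (c⁻¹ * τ)) (c * t)) x := by
      simp only [inv_mul_cancel_left₀ hc.ne']
      rw [scalarCurvatureWith_constSmul]
      -- from `(r'(ct)/√c)⁻² = c (r'(ct))⁻² ≤ R`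
      have hr0 : 0 < r' (c * t) := hr'pos _ (by simpa using hct.1)
      have key : (r' (c * t) / Real.sqrt c)⁻¹ ^ 2 = c * (r' (c * t))⁻¹ ^ 2 := by
        rw [inv_div, div_pow, Real.sq_sqrt hc.le, inv_pow]
        field_simp
      rw [key] at hR
      calc (r' (c * t))⁻¹ ^ 2 = c⁻¹ * (c * (r' (c * t))⁻¹ ^ 2) := by
            rw [inv_mul_cancel_left₀ hc.ne']
        _ ≤ c⁻¹ * (g t).scalarCurvatureWith (cov t) x :=
            mul_le_mul_of_nonneg_left hR (inv_nonneg.mpr hc.le)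
    have hcn := (Hcn (c * t) hct x hR').parabolicRescale (inv_pos.mpr hc) hct
    -- undo the rescaling: `c⁻¹ • (c • g((c⁻¹)⁻¹ c⁻¹ τ…)) = g τ`
    have hgfun : (fun τ ↦ ((fun t ↦ (g (c⁻¹ * t)).constSmul c hc.ne') ((c⁻¹)⁻¹ * τ)).constSmul c⁻¹
        (inv_pos.mpr hc).ne') = g := by
      funext τ
      simp only [inv_inv, inv_mul_cancel_left₀ hc.ne', constSmul_inv_constSmul]
    have hcovfun : (fun τ ↦ (fun t ↦ cov (c⁻¹ * t)) ((c⁻¹)⁻¹ * τ)) = cov := by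
      funext τ
      simp only [inv_inv, inv_mul_cancel_left₀ hc.ne']
    rw [hgfun, hcovfun, inv_mul_cancel_left₀ hc.ne', inv_mul_cancel_left₀ hc.ne'] at hcn
    exact hcn

end Literature.Geometry.Riemannian

end
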